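import Literature.NumberTheory.Automorphic.GL2ComplexCasimirScalar
import Literature.Algebra.Lie.ChevalleyEilenbergCasimirHomotopy
import Mathlib.RingTheory.AlgebraTower
import Mathlib.LinearAlgebra.Matrix.StdBasis
import HarnessLib

/-!
# The real trace forms `B₊ = Re tr(XY)`, `B₋ = Im tr(XY)` on `𝔤𝔩ₙ(ℂ)`, their canonical tensors,
# and the real Casimir elements `C₊`, `C₋` as Casimir operators of invariant forms

Topic `NumberTheory/Automorphic`; a companion of `GL2ComplexCasimirScalar` (which defines the central
elements `casPlus n = C₊`, `casMinus n = C₋` of the REAL enveloping algebra `U_ℝ(𝔤𝔩ₙ(ℂ))` by explicit sums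
over the matrix units and proves their centrality by hand) and of the Chevalley–Eilenberg Casimir homotopy
(`Literature.Algebra.Lie.ChevalleyEilenbergCasimirHomotopy`, whose input is an INVARIANT 2-tensor
`∑_s y_s ⊗ y'_s`).  This file identifies `C₊`, `C₋` as the Casimir elements of invariant symmetric
non-degenerate real bilinear forms (Knapp 2002, §V.4, Prop. 5.24: the Casimir element `∑ X_i X^i` of a
non-degenerate invariant form, `X^i` the dual basis), which is what makes the homotopy applicable to them:

* `reTraceForm n = B₊`, `imTraceForm n = B₋` (`LinearMap.BilinForm ℝ` on `Matrix (Fin n) (Fin n) ℂ`):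
  symmetric (`…_isSymm`), `ad`-invariant (`…_lieInvariant`, from `tr([X,Y]Z) = -tr(Y[X,Z])`,
  `trace_lie_mul`), `Ad(GLₙ(ℂ))`-invariant (`…_conj`), non-degenerate (`…_nondegenerate`);
* the real basis `cplxBasis n (k, a, b) = e_k E_{ab}`, `(e₀, e₁) = (1, i)` (Mathlib's `Complex.basisOneI`
  towered over `Matrix.stdBasis`), and the dual bases: `(e_k E_{ab})^∨ = conj(e_k) E_{ba}` for `B₊`
  (`dualBasis_reTraceForm`) and `i conj(e_k) E_{ba}` for `B₋` (`dualBasis_imTraceForm`);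
* **`sum_rho_cplxBasis_mul_rho_dualRe`, `sum_rho_cplxBasis_mul_rho_dualIm`**: for every real Lie algebra
  representation `ρ : 𝔤𝔩ₙ(ℂ) →ₗ⁅ℝ⁆ End_ℂ V`, `∑_x ρ(b_x) ρ(b_x^∨) = ρ(C₊)` resp. `ρ(C₋)` (Knapp (5.24));
* the canonical tensors `∑_x b_x ⊗ b_x^∨ ∈ 𝔤𝔩ₙ(ℂ) ⊗_ℝ 𝔤𝔩ₙ(ℂ)` are `ad`-invariant
  (`sum_lie_cplxBasis_tmul_dualRe/Im`, the hypothesis `hT` of the Casimir homotopy), `Ad(GLₙ(ℂ))`-invariant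
  (`sum_adEquiv_cplxBasis_tmul_adEquiv_dualRe/Im`, hypothesis `hTK`; `adEquiv g X = g X g⁻¹`) and
  symmetric (`sum_dualRe/Im_tmul_cplxBasis`, hypothesis `hTs`) — all three by the general bridge lemmas
  `Literature.Algebra.Lie.sum_lie_basis_tmul_dualBasis_add`, `sum_map_basis_tmul_dualBasis`,
  `sum_dualBasis_tmul_basis` of the homotopy file.

Everything is proved; the only definitions are the two forms, the basis, the packaging `prodBilin` and
`adEquiv`.  Used at a complex place of a number field by the `(𝔤, K∞)`-cohomology computation of the
infinitesimal character of cohomological representations (`GKCohomologyCasimir`).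

## References

* A. W. Knapp, *Lie Groups Beyond an Introduction*, 2nd ed. (2002), §I.8, §V.4 (Prop. 5.24, (5.24)).
  [Knapp2002]
* C. Chevalley, S. Eilenberg, *Cohomology theory of Lie groups and Lie algebras*, Trans. AMS 63 (1948),
  §24. [ChevalleyEilenberg1948]
-/

noncomputable section

-- Mathlib idiom (Mathlib/Algebra/Lie/OfAssociative.lean), as in `GL2ComplexCasimirScalar`: commutator brackets on
-- matrix algebras and on `Module.End`.
attribute [local instance 100] LieRing.ofAssociativeRing

open scoped Matrix ComplexConjugate TensorProduct
open Complex UniversalEnvelopingAlgebra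

namespace Literature.NumberTheory.Automorphic

namespace GLnComplexCasimir

open HCSpan

variable (n : ℕ)

/-! ### The real and imaginary parts of the trace form -/

/-- **The real trace form** `B₊(X, Y) = Re tr(XY)` on `𝔤𝔩ₙ(ℂ)` regarded as a REAL Lie algebra: a
non-degenerate symmetric invariant real bilinear form (Knapp 2002, §V.4; its Casimir element is `C₊`).
[cite: Knapp2002, §V.4] -/
def reTraceForm : LinearMap.BilinForm ℝ (Matrix (Fin n) (Fin n) ℂ) :=
  LinearMap.mk₂ ℝ (fun X Y => ((X * Y).trace).re)
    (fun X X' Y => by rw [Matrix.add_mul, Matrix.trace_add, Complex.add_re])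
    (fun c X Y => by rw [Matrix.smul_mul, Matrix.trace_smul, Complex.smul_re, smul_eq_mul])
    (fun X Y Y' => by rw [Matrix.mul_add, Matrix.trace_add, Complex.add_re])
    (fun c X Y => by rw [Matrix.mul_smul, Matrix.trace_smul, Complex.smul_re, smul_eq_mul])

/-- **The imaginary trace form** `B₋(X, Y) = Im tr(XY)` on `𝔤𝔩ₙ(ℂ)` as a real Lie algebra (its
Casimir element is `C₋`). [cite: Knapp2002, §V.4] -/
def imTraceForm : LinearMap.BilinForm ℝ (Matrix (Fin n) (Fin n) ℂ) :=
  LinearMap.mk₂ ℝ (fun X Y => ((X * Y).trace).im)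
    (fun X X' Y => by rw [Matrix.add_mul, Matrix.trace_add, Complex.add_im])
    (fun c X Y => by rw [Matrix.smul_mul, Matrix.trace_smul, Complex.smul_im, smul_eq_mul])
    (fun X Y Y' => by rw [Matrix.mul_add, Matrix.trace_add, Complex.add_im])
    (fun c X Y => by rw [Matrix.mul_smul, Matrix.trace_smul, Complex.smul_im, smul_eq_mul])

variable {n}

/-- Unfolding. [folklore] -/
@[simp] theorem reTraceForm_apply (X Y : Matrix (Fin n) (Fin n) ℂ) :
    reTraceForm n X Y = ((X * Y).trace).re := rfl

/-- Unfolding. [folklore] -/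
@[simp] theorem imTraceForm_apply (X Y : Matrix (Fin n) (Fin n) ℂ) :
    imTraceForm n X Y = ((X * Y).trace).im := rfl

/-- `tr([X,Y] Z) = -tr(Y [X,Z])` (invariance of the complex trace form). [cite: Knapp2002, §I.8] -/
theorem trace_lie_mul (X Y Z : Matrix (Fin n) (Fin n) ℂ) :
    (⁅X, Y⁆ * Z).trace = -(Y * ⁅X, Z⁆).trace := by
  simp only [Ring.lie_def, Matrix.sub_mul, Matrix.mul_sub, Matrix.trace_sub]
  rw [← Matrix.mul_assoc Y Z X, Matrix.trace_mul_cycle Y Z X, Matrix.mul_assoc X Y Z,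
    Matrix.mul_assoc Y X Z]
  ring

variable (n) in
/-- `B₊` is symmetric. [folklore] -/
theorem reTraceForm_isSymm : (reTraceForm n).IsSymm :=
  ⟨fun X Y => by rw [reTraceForm_apply, reTraceForm_apply, Matrix.trace_mul_comm]⟩

variable (n) in
/-- `B₋` is symmetric. [folklore] -/
theorem imTraceForm_isSymm : (imTraceForm n).IsSymm :=
  ⟨fun X Y => by rw [imTraceForm_apply, imTraceForm_apply, Matrix.trace_mul_comm]⟩

variable (n) in
/-- `B₊` is invariant: `B₊([X,Y], Z) = -B₊(Y, [X,Z])`. [cite: Knapp2002, §I.8] -/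
theorem reTraceForm_lieInvariant : (reTraceForm n).lieInvariant (Matrix (Fin n) (Fin n) ℂ) := by
  intro X Y Z
  rw [reTraceForm_apply, reTraceForm_apply, trace_lie_mul, Complex.neg_re]

variable (n) in
/-- `B₋` is invariant. [cite: Knapp2002, §I.8] -/
theorem imTraceForm_lieInvariant : (imTraceForm n).lieInvariant (Matrix (Fin n) (Fin n) ℂ) := by
  intro X Y Z
  rw [imTraceForm_apply, imTraceForm_apply, trace_lie_mul, Complex.neg_im]

/-- `tr((gXg⁻¹)(gYg⁻¹)) = tr(XY)`. [folklore] -/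
theorem trace_conj_mul_conj (g : GL (Fin n) ℂ) (X Y : Matrix (Fin n) (Fin n) ℂ) :
    (((g : Matrix (Fin n) (Fin n) ℂ) * X * ((g⁻¹ : GL (Fin n) ℂ) : Matrix (Fin n) (Fin n) ℂ)) *
        ((g : Matrix (Fin n) (Fin n) ℂ) * Y * ((g⁻¹ : GL (Fin n) ℂ) : Matrix (Fin n) (Fin n) ℂ))).trace =
      (X * Y).trace := by
  set gm : Matrix (Fin n) (Fin n) ℂ := (g : Matrix (Fin n) (Fin n) ℂ) with hgm
  set gi : Matrix (Fin n) (Fin n) ℂ := ((g⁻¹ : GL (Fin n) ℂ) : Matrix (Fin n) (Fin n) ℂ) with hgi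
  have hinv : gi * gm = 1 := by
    rw [hgi, hgm, ← Units.val_mul, inv_mul_cancel, Units.val_one]
  have e : gm * X * gi * (gm * Y * gi) = gm * (X * Y) * gi := by
    rw [Matrix.mul_assoc (gm * X) gi (gm * Y * gi), ← Matrix.mul_assoc gi (gm * Y) gi,
      ← Matrix.mul_assoc gi gm Y, hinv, Matrix.one_mul, ← Matrix.mul_assoc (gm * X) Y gi,
      Matrix.mul_assoc gm X Y]
  rw [e, Matrix.trace_mul_cycle, hinv, Matrix.one_mul]

/-- `B₊` is `Ad(GLₙ(ℂ))`-invariant. [cite: Knapp2002, §V.4] -/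
theorem reTraceForm_conj (g : GL (Fin n) ℂ) (X Y : Matrix (Fin n) (Fin n) ℂ) :
    reTraceForm n ((g : Matrix (Fin n) (Fin n) ℂ) * X * ((g⁻¹ : GL (Fin n) ℂ) : Matrix (Fin n) (Fin n) ℂ))
        ((g : Matrix (Fin n) (Fin n) ℂ) * Y * ((g⁻¹ : GL (Fin n) ℂ) : Matrix (Fin n) (Fin n) ℂ)) =
      reTraceForm n X Y := by
  rw [reTraceForm_apply, reTraceForm_apply, trace_conj_mul_conj]

/-- `B₋` is `Ad(GLₙ(ℂ))`-invariant. [cite: Knapp2002, §V.4] -/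
theorem imTraceForm_conj (g : GL (Fin n) ℂ) (X Y : Matrix (Fin n) (Fin n) ℂ) :
    imTraceForm n ((g : Matrix (Fin n) (Fin n) ℂ) * X * ((g⁻¹ : GL (Fin n) ℂ) : Matrix (Fin n) (Fin n) ℂ))
        ((g : Matrix (Fin n) (Fin n) ℂ) * Y * ((g⁻¹ : GL (Fin n) ℂ) : Matrix (Fin n) (Fin n) ℂ)) =
      imTraceForm n X Y := by
  rw [imTraceForm_apply, imTraceForm_apply, trace_conj_mul_conj]

/-! ### A real basis of `𝔤𝔩ₙ(ℂ)` and the dual bases for `B₊`, `B₋` -/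

variable (n) in
/-- The real basis `{E_{ab}, iE_{ab}}` of `𝔤𝔩ₙ(ℂ)`: `(k, (a, b)) ↦ e_k E_{ab}` with `(e₀, e₁) = (1, i)`
(Mathlib's `Complex.basisOneI` towered over the matrix units). [folklore] -/
def cplxBasis : Module.Basis (Fin 2 × (Fin n × Fin n)) ℝ (Matrix (Fin n) (Fin n) ℂ) :=
  Complex.basisOneI.smulTower (Matrix.stdBasis ℂ (Fin n) (Fin n))

/-- `cplxBasis (k, (a, b)) = e_k E_{ab}`. [folklore] -/
theorem cplxBasis_apply (k : Fin 2) (p : Fin n × Fin n) :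
    cplxBasis n (k, p) = Matrix.single p.1 p.2 (Complex.basisOneI k) := by
  classical
  rw [cplxBasis, Module.Basis.smulTower_apply, Matrix.stdBasis_eq_single, Matrix.smul_single,
    smul_eq_mul, mul_one]

/-- `tr(z E_{ab} · z' E_{cd}) = δ_{bc} δ_{ad} z z'`. [folklore] -/
theorem trace_single_mul_single (a b c d : Fin n) (z z' : ℂ) :
    (Matrix.single a b z * Matrix.single c d z').trace = if c = b ∧ d = a then z * z' else 0 := by
  rw [Matrix.trace_single_mul, smul_eq_mul, Matrix.single_apply]
  split_ifs <;> simp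

/-- The values of the basis: `e₀ = 1`, `e₁ = i`. [folklore] -/
theorem basisOneI_eq (k : Fin 2) : Complex.basisOneI k = if k = 0 then 1 else I := by
  fin_cases k <;> simp [Complex.coe_basisOneI]

/-- `Re(conj e_k · e_l) = δ_{kl}`. [folklore] -/
theorem re_conj_basisOneI_mul (k l : Fin 2) :
    (conj (Complex.basisOneI k) * Complex.basisOneI l).re = if l = k then 1 else 0 := by
  fin_cases k <;> fin_cases l <;> simp [Complex.coe_basisOneI]

/-- `Im(i conj e_k · e_l) = δ_{kl}`. [folklore] -/
theorem im_I_conj_basisOneI_mul (k l : Fin 2) :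
    (I * conj (Complex.basisOneI k) * Complex.basisOneI l).im = if l = k then 1 else 0 := by
  fin_cases k <;> fin_cases l <;> simp [Complex.coe_basisOneI]

variable (n) in
/-- `B₊` is non-degenerate. [folklore] -/
theorem reTraceForm_nondegenerate : (reTraceForm n).Nondegenerate := by
  have key : ∀ X : Matrix (Fin n) (Fin n) ℂ, (∀ Y, reTraceForm n X Y = 0) → X = 0 := by
    intro X hX
    ext a b
    have h1 := hX (Matrix.single b a 1)
    have hI := hX (Matrix.single b a (-I))
    rw [reTraceForm_apply, Matrix.trace_mul_single, MulOpposite.smul_eq_mul_unop,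
      MulOpposite.unop_op] at h1 hI
    have hre : (X a b).re = 0 := by simpa using h1
    have him : (X a b).im = 0 := by simpa [Complex.mul_re] using hI
    rw [Matrix.zero_apply]
    exact Complex.ext hre him
  refine ⟨fun X hX => key X hX, fun Y hY => key Y fun X => ?_⟩
  rw [(reTraceForm_isSymm n).eq]
  exact hY X

variable (n) in
/-- `B₋` is non-degenerate. [folklore] -/
theorem imTraceForm_nondegenerate : (imTraceForm n).Nondegenerate := by
  have key : ∀ X : Matrix (Fin n) (Fin n) ℂ, (∀ Y, imTraceForm n X Y = 0) → X = 0 := by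
    intro X hX
    ext a b
    have h1 := hX (Matrix.single b a 1)
    have hI := hX (Matrix.single b a I)
    rw [imTraceForm_apply, Matrix.trace_mul_single, MulOpposite.smul_eq_mul_unop,
      MulOpposite.unop_op] at h1 hI
    have him : (X a b).im = 0 := by simpa using h1
    have hre : (X a b).re = 0 := by simpa [Complex.mul_im] using hI
    rw [Matrix.zero_apply]
    exact Complex.ext hre him
  refine ⟨fun X hX => key X hX, fun Y hY => key Y fun X => ?_⟩
  rw [(imTraceForm_isSymm n).eq]
  exact hY X

/-- **The `B₊`-dual basis**: `(e_k E_{ab})^∨ = conj(e_k) E_{ba}` (`E_{ab} ↔ E_{ba}`, `iE_{ab} ↔ -iE_{ba}`).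
[cite: Knapp2002, §V.4] -/
theorem dualBasis_reTraceForm (x : Fin 2 × (Fin n × Fin n)) :
    (reTraceForm n).dualBasis (reTraceForm_nondegenerate n) (cplxBasis n) x =
      Matrix.single x.2.2 x.2.1 (conj (Complex.basisOneI x.1)) := by
  classical
  have h := (LinearMap.BilinForm.dualBasis_eq_iff (reTraceForm_nondegenerate n) (cplxBasis n)
    (fun y : Fin 2 × (Fin n × Fin n) => Matrix.single y.2.2 y.2.1 (conj (Complex.basisOneI y.1)))).2 ?_
  · exact congrFun h x
  · rintro ⟨k, a, b⟩ ⟨l, c, d⟩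
    rw [cplxBasis_apply, reTraceForm_apply, trace_single_mul_single]
    by_cases hca : c = a
    · by_cases hdb : d = b
      · subst hca; subst hdb
        simp only [and_self, ↓reduceIte, re_conj_basisOneI_mul, Prod.mk.injEq, and_true]
      · simp [hdb]
    · simp [hca]

/-- **The `B₋`-dual basis**: `(e_k E_{ab})^∨ = i conj(e_k) E_{ba}` (`E_{ab} ↔ iE_{ba}`, `iE_{ab} ↔ E_{ba}`).
[cite: Knapp2002, §V.4] -/
theorem dualBasis_imTraceForm (x : Fin 2 × (Fin n × Fin n)) :
    (imTraceForm n).dualBasis (imTraceForm_nondegenerate n) (cplxBasis n) x =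
      Matrix.single x.2.2 x.2.1 (I * conj (Complex.basisOneI x.1)) := by
  classical
  have h := (LinearMap.BilinForm.dualBasis_eq_iff (imTraceForm_nondegenerate n) (cplxBasis n)
    (fun y : Fin 2 × (Fin n × Fin n) => Matrix.single y.2.2 y.2.1 (I * conj (Complex.basisOneI y.1)))).2 ?_
  · exact congrFun h x
  · rintro ⟨k, a, b⟩ ⟨l, c, d⟩
    rw [cplxBasis_apply, imTraceForm_apply, trace_single_mul_single]
    by_cases hca : c = a
    · by_cases hdb : d = b
      · subst hca; subst hdb
        simp only [and_self, ↓reduceIte, im_I_conj_basisOneI_mul, Prod.mk.injEq, and_true]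
      · simp [hdb]
    · simp [hca]

/-! ### The canonical tensors and the operators `C₊`, `C₋` -/

/-- Sums over the real basis, made explicit: `∑_x Φ(b_x)(b_x^∨) = ∑_{a,b} (Φ(E_{ab})(E_{ba}) + Φ(iE_{ab})(-iE_{ba}))`
for `B₊`. [folklore] -/
theorem sum_cplxBasis_dualRe {P : Type*} [AddCommGroup P] [Module ℝ P]
    (Φ : Matrix (Fin n) (Fin n) ℂ →ₗ[ℝ] Matrix (Fin n) (Fin n) ℂ →ₗ[ℝ] P) :
    ∑ x, Φ (cplxBasis n x) ((reTraceForm n).dualBasis (reTraceForm_nondegenerate n) (cplxBasis n) x) =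
      ∑ a, ∑ b, (Φ (Matrix.single a b 1) (Matrix.single b a 1) -
        Φ (Matrix.single a b I) (Matrix.single b a I)) := by
  simp only [dualBasis_reTraceForm, Fintype.sum_prod_type, cplxBasis_apply, Fin.sum_univ_two,
    Complex.coe_basisOneI, Matrix.cons_val_zero, Matrix.cons_val_one, map_one, conj_I,
    ← Finset.sum_add_distrib]
  refine Finset.sum_congr rfl fun a _ => Finset.sum_congr rfl fun b _ => ?_
  have h : Matrix.single b a (-I) = -Matrix.single b a I := map_neg (Matrix.singleLinearMap ℝ b a) I
  rw [h, map_neg, sub_eq_add_neg]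

/-- The same for `B₋`: `∑_x Φ(b_x)(b_x^∨) = ∑_{a,b} (Φ(E_{ab})(iE_{ba}) + Φ(iE_{ab})(E_{ba}))`. [folklore] -/
theorem sum_cplxBasis_dualIm {P : Type*} [AddCommGroup P] [Module ℝ P]
    (Φ : Matrix (Fin n) (Fin n) ℂ →ₗ[ℝ] Matrix (Fin n) (Fin n) ℂ →ₗ[ℝ] P) :
    ∑ x, Φ (cplxBasis n x) ((imTraceForm n).dualBasis (imTraceForm_nondegenerate n) (cplxBasis n) x) =
      ∑ a, ∑ b, (Φ (Matrix.single a b 1) (Matrix.single b a I) +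
        Φ (Matrix.single a b I) (Matrix.single b a 1)) := by
  simp only [dualBasis_imTraceForm, Fintype.sum_prod_type, cplxBasis_apply, Fin.sum_univ_two,
    Complex.coe_basisOneI, Matrix.cons_val_zero, Matrix.cons_val_one, map_one, conj_I, mul_one,
    mul_neg, I_mul_I, neg_neg, ← Finset.sum_add_distrib]

/-- The real-bilinear product map `(X, Y) ↦ ρ(X) ρ'(Y)` (packaging). [folklore] -/
def prodBilin {V : Type*} [AddCommGroup V] [Module ℂ V] (ρ ρ' : Matrix (Fin n) (Fin n) ℂ →ₗ⁅ℝ⁆ Module.End ℂ V) :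
    Matrix (Fin n) (Fin n) ℂ →ₗ[ℝ] Matrix (Fin n) (Fin n) ℂ →ₗ[ℝ] Module.End ℂ V :=
  LinearMap.mk₂ ℝ (fun X Y => ρ X * ρ' Y)
    (fun u u' v => by rw [map_add, add_mul])
    (fun c u v => by
      change ρ (c • u) * ρ' v = (c : ℂ) • (ρ u * ρ' v)
      rw [map_smul, ← smul_mul_assoc]; rfl)
    (fun u v v' => by rw [map_add, mul_add])
    (fun c u v => by
      change ρ u * ρ' (c • v) = (c : ℂ) • (ρ u * ρ' v)
      rw [map_smul, ← mul_smul_comm]; rfl)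

/-- Unfolding. [folklore] -/
@[simp] theorem prodBilin_apply {V : Type*} [AddCommGroup V] [Module ℂ V]
    (ρ ρ' : Matrix (Fin n) (Fin n) ℂ →ₗ⁅ℝ⁆ Module.End ℂ V) (X Y : Matrix (Fin n) (Fin n) ℂ) :
    prodBilin ρ ρ' X Y = ρ X * ρ' Y := rfl

/-- **`C₊` is the Casimir operator of `B₊`**: `∑_x ρ(b_x) ρ(b_x^∨) = ρ(C₊)` for every real Lie algebra
representation `ρ` of `𝔤𝔩ₙ(ℂ)`. [cite: Knapp2002, §V.4 (5.24)] -/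
theorem sum_rho_cplxBasis_mul_rho_dualRe {V : Type*} [AddCommGroup V] [Module ℂ V]
    (ρ : Matrix (Fin n) (Fin n) ℂ →ₗ⁅ℝ⁆ Module.End ℂ V) :
    ∑ x, ρ (cplxBasis n x) * ρ ((reTraceForm n).dualBasis (reTraceForm_nondegenerate n) (cplxBasis n) x) =
      lift ℝ ρ (casPlus n) := by
  have h := sum_cplxBasis_dualRe (prodBilin ρ ρ)
  simp only [prodBilin_apply] at h
  rw [h, casPlus, casU, casU, map_sub]
  simp only [map_sum, map_mul, gen_apply, Finset.sum_sub_distrib, lift_ι_apply]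

/-- **`C₋` is the Casimir operator of `B₋`**: `∑_x ρ(b_x) ρ(b_x^∨) = ρ(C₋)`. [cite: Knapp2002, §V.4 (5.24)] -/
theorem sum_rho_cplxBasis_mul_rho_dualIm {V : Type*} [AddCommGroup V] [Module ℂ V]
    (ρ : Matrix (Fin n) (Fin n) ℂ →ₗ⁅ℝ⁆ Module.End ℂ V) :
    ∑ x, ρ (cplxBasis n x) * ρ ((imTraceForm n).dualBasis (imTraceForm_nondegenerate n) (cplxBasis n) x) =
      lift ℝ ρ (casMinus n) := by
  have h := sum_cplxBasis_dualIm (prodBilin ρ ρ)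
  simp only [prodBilin_apply] at h
  rw [h, casMinus, casU, casU, map_add]
  simp only [map_sum, map_mul, gen_apply, Finset.sum_add_distrib, lift_ι_apply]

/-! ### Invariance of the canonical tensors -/

/-- `𝔤`-invariance of the `B₊`-tensor. [folklore] -/
theorem sum_lie_cplxBasis_tmul_dualRe (X : Matrix (Fin n) (Fin n) ℂ) :
    ∑ x, (⁅X, cplxBasis n x⁆ ⊗ₜ[ℝ] (reTraceForm n).dualBasis (reTraceForm_nondegenerate n) (cplxBasis n) x +
      cplxBasis n x ⊗ₜ[ℝ] ⁅X, (reTraceForm n).dualBasis (reTraceForm_nondegenerate n) (cplxBasis n) x⁆) =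
        (0 : Matrix (Fin n) (Fin n) ℂ ⊗[ℝ] Matrix (Fin n) (Fin n) ℂ) :=
  Literature.Algebra.Lie.sum_lie_basis_tmul_dualBasis_add (reTraceForm_nondegenerate n) (reTraceForm_isSymm n)
    (reTraceForm_lieInvariant n) (cplxBasis n) X

/-- `𝔤`-invariance of the `B₋`-tensor. [folklore] -/
theorem sum_lie_cplxBasis_tmul_dualIm (X : Matrix (Fin n) (Fin n) ℂ) :
    ∑ x, (⁅X, cplxBasis n x⁆ ⊗ₜ[ℝ] (imTraceForm n).dualBasis (imTraceForm_nondegenerate n) (cplxBasis n) x +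
      cplxBasis n x ⊗ₜ[ℝ] ⁅X, (imTraceForm n).dualBasis (imTraceForm_nondegenerate n) (cplxBasis n) x⁆) =
        (0 : Matrix (Fin n) (Fin n) ℂ ⊗[ℝ] Matrix (Fin n) (Fin n) ℂ) :=
  Literature.Algebra.Lie.sum_lie_basis_tmul_dualBasis_add (imTraceForm_nondegenerate n) (imTraceForm_isSymm n)
    (imTraceForm_lieInvariant n) (cplxBasis n) X

/-- The conjugation `X ↦ g X g⁻¹` by `g ∈ GLₙ(ℂ)` as a real-linear automorphism of `𝔤𝔩ₙ(ℂ)`. [folklore] -/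
def adEquiv (g : GL (Fin n) ℂ) : Matrix (Fin n) (Fin n) ℂ ≃ₗ[ℝ] Matrix (Fin n) (Fin n) ℂ where
  toFun X := (g : Matrix (Fin n) (Fin n) ℂ) * X * ((g⁻¹ : GL (Fin n) ℂ) : Matrix (Fin n) (Fin n) ℂ)
  invFun X := ((g⁻¹ : GL (Fin n) ℂ) : Matrix (Fin n) (Fin n) ℂ) * X * (g : Matrix (Fin n) (Fin n) ℂ)
  map_add' X Y := by rw [Matrix.mul_add, Matrix.add_mul]
  map_smul' c X := by rw [Matrix.mul_smul, Matrix.smul_mul, RingHom.id_apply]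
  left_inv X := by
    have h : ((g⁻¹ : GL (Fin n) ℂ) : Matrix (Fin n) (Fin n) ℂ) * (g : Matrix (Fin n) (Fin n) ℂ) = 1 := by
      rw [← Units.val_mul, inv_mul_cancel, Units.val_one]
    change ((g⁻¹ : GL (Fin n) ℂ) : Matrix (Fin n) (Fin n) ℂ) *
      ((g : Matrix (Fin n) (Fin n) ℂ) * X * ((g⁻¹ : GL (Fin n) ℂ) : Matrix (Fin n) (Fin n) ℂ)) * g = X
    rw [← Matrix.mul_assoc, ← Matrix.mul_assoc, h, Matrix.one_mul, Matrix.mul_assoc, h, Matrix.mul_one]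
  right_inv X := by
    have h : (g : Matrix (Fin n) (Fin n) ℂ) * ((g⁻¹ : GL (Fin n) ℂ) : Matrix (Fin n) (Fin n) ℂ) = 1 := by
      rw [← Units.val_mul, mul_inv_cancel, Units.val_one]
    change (g : Matrix (Fin n) (Fin n) ℂ) *
      (((g⁻¹ : GL (Fin n) ℂ) : Matrix (Fin n) (Fin n) ℂ) * X * (g : Matrix (Fin n) (Fin n) ℂ)) *
        ((g⁻¹ : GL (Fin n) ℂ) : Matrix (Fin n) (Fin n) ℂ) = X
    rw [← Matrix.mul_assoc, ← Matrix.mul_assoc, h, Matrix.one_mul, Matrix.mul_assoc, h, Matrix.mul_one]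

/-- Unfolding. [folklore] -/
@[simp] theorem adEquiv_apply (g : GL (Fin n) ℂ) (X : Matrix (Fin n) (Fin n) ℂ) :
    adEquiv g X = (g : Matrix (Fin n) (Fin n) ℂ) * X * ((g⁻¹ : GL (Fin n) ℂ) : Matrix (Fin n) (Fin n) ℂ) := rfl

/-- `Ad(GLₙ(ℂ))`-invariance of the `B₊`-tensor. [cite: Knapp2002, §V.4] -/
theorem sum_adEquiv_cplxBasis_tmul_adEquiv_dualRe (g : GL (Fin n) ℂ) :
    ∑ x, adEquiv g (cplxBasis n x) ⊗ₜ[ℝ]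
        adEquiv g ((reTraceForm n).dualBasis (reTraceForm_nondegenerate n) (cplxBasis n) x) =
      ∑ x, cplxBasis n x ⊗ₜ[ℝ] (reTraceForm n).dualBasis (reTraceForm_nondegenerate n) (cplxBasis n) x :=
  Literature.Algebra.Lie.sum_map_basis_tmul_dualBasis (reTraceForm_nondegenerate n) (reTraceForm_isSymm n)
    (cplxBasis n) (adEquiv g) (fun X Y => reTraceForm_conj g X Y)

/-- `Ad(GLₙ(ℂ))`-invariance of the `B₋`-tensor. [cite: Knapp2002, §V.4] -/
theorem sum_adEquiv_cplxBasis_tmul_adEquiv_dualIm (g : GL (Fin n) ℂ) :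
    ∑ x, adEquiv g (cplxBasis n x) ⊗ₜ[ℝ]
        adEquiv g ((imTraceForm n).dualBasis (imTraceForm_nondegenerate n) (cplxBasis n) x) =
      ∑ x, cplxBasis n x ⊗ₜ[ℝ] (imTraceForm n).dualBasis (imTraceForm_nondegenerate n) (cplxBasis n) x :=
  Literature.Algebra.Lie.sum_map_basis_tmul_dualBasis (imTraceForm_nondegenerate n) (imTraceForm_isSymm n)
    (cplxBasis n) (adEquiv g) (fun X Y => imTraceForm_conj g X Y)

/-- Symmetry of the `B₊`-tensor. [folklore] -/
theorem sum_dualRe_tmul_cplxBasis :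
    ∑ x, (reTraceForm n).dualBasis (reTraceForm_nondegenerate n) (cplxBasis n) x ⊗ₜ[ℝ] cplxBasis n x =
      ∑ x, cplxBasis n x ⊗ₜ[ℝ] (reTraceForm n).dualBasis (reTraceForm_nondegenerate n) (cplxBasis n) x :=
  Literature.Algebra.Lie.sum_dualBasis_tmul_basis (reTraceForm_nondegenerate n) (reTraceForm_isSymm n) (cplxBasis n)

/-- Symmetry of the `B₋`-tensor. [folklore] -/
theorem sum_dualIm_tmul_cplxBasis :
    ∑ x, (imTraceForm n).dualBasis (imTraceForm_nondegenerate n) (cplxBasis n) x ⊗ₜ[ℝ] cplxBasis n x =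
      ∑ x, cplxBasis n x ⊗ₜ[ℝ] (imTraceForm n).dualBasis (imTraceForm_nondegenerate n) (cplxBasis n) x :=
  Literature.Algebra.Lie.sum_dualBasis_tmul_basis (imTraceForm_nondegenerate n) (imTraceForm_isSymm n) (cplxBasis n)

end GLnComplexCasimir

end Literature.NumberTheory.Automorphic

end
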